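import Summits.RiemannHypothesis.RiemannHypothesis.Theorems.Splittings.JensenMixedSplitRows
import HarnessLib

/-!
# Splittings / Jensen — the mixed-split witness, part 3/3: every zero of `F'_{(kπ)²,ε}` is real, and the
# mixed-split exchange schema is REFUTED AT CLASS LEVEL, HYPOTHESIS-FREE

Cell rh-split, seat rh-split-jen-bridge gen 3 (§§5–6 of `HOME/rh-split-jen-bridge/SketchG3.lean`; card
`cards/SPLIT-jen-bridge.md` §10; referee g2 content PRE-FILE PASS 2026-08-27T00:39Z: «g2's paper input [D] now
KERNEL … not_mixedSplit_schema HYPOTHESIS-FREE; book change on landing: jen×bridge V4/T5 "REFUTED mod [D]" ⟶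
"REFUTED UNCONDITIONALLY at class level (kernel, std)"; on ξ itself UNDECIDED; class jen×bridge UNCHANGED»);
filed zero-def by rh-split-typer-1 g3 (G1, option C).

Zero-definition raw form (cell convention): the seat's `Fw c ε` is SPELLED OUT everywhere as the lambda
`fun w : ℂ ↦ ((w + c) ^ 2 + (ε : ℂ) ^ 2) * coshSqrt w` (`coshSqrt` = the tree's `cosh √·`,
`Literature.Barriers.RiemannHypothesis.JensenPolynomialsSqrt`), its values beta-reduced
(`((w + c)² + ε²)·cosh √w`), the planted pair `w± = -c ± iε` as `-(c : ℂ) ± ε * I`, the sea zeros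
`s_j = -((2j+1)π/2)²` literally, and the seat's Props `DerivZerosReal c ε` («every zero of `F'_{c,ε}` is
real») / `MixedSplitWitness C D F` as the written-out `∀` / conjunction.

* §5 `derivZerosReal_Fw : 1 ≤ k → 0 < ε → ε ≤ 1 → ∀ w, F'_{(kπ)²,ε}(w) = 0 → Im w = 0` — no Rouché, no argument
  principle: with `z = w + c`, `C = cosh √w`, `q = z² + ε²`, `w = u²`: OUTSIDE the Jensen disc (`‖z‖ ≥ ε`,
  `Im w ≠ 0`) an imaginary-part sign identity for `2u·F' = 4zu·cosh u + q·sinh u` against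
  `t sin t < t² < t sinh t` (`deriv_Fw_ne_zero_of_le_norm`); INSIDE (`0 < ‖z‖ < ε ≤ 1`) a norm comparison
  `‖2zC‖ ≥ 16‖z‖/9 > ‖z‖/4 ≥ ‖qC'‖` near `u₀ = kπ·i` (`deriv_Fw_ne_zero_of_norm_lt`); and the real critical
  zero `F'(-c) = 0` (`deriv_Fw_neg_c`, non-vacuity).
* §6 `mixedSplitWitness_Fw'`, `exists_mixedSplitWitness'` (every threshold pair `(C, D)` has a witness,
  unconditionally) and **`not_mixedSplit_schema C D`**: for no `(C, D)` does «zeros of modulus `≤ C` real ∧ rows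
  `n ≥ 1` hyperbolic ∧ degrees `d ≤ D` hyperbolic ∧ finitely many non-real zeros ∧ `EventuallyHyperbolic` ⟹
  `AllHyperbolic`» hold for every real entire `F` of order `< 1` with `F 0 ≠ 0` — the class in which Pólya's
  criterion places `xiSq`. Any exchange lemma of this shape for `ξ` must use `ξ`-specific input. On `ξ` itself:
  UNDECIDED. Not a claim about RH.

HONEST LABEL: «SPLITTING SEARCH over kernel-typed RH-EQUIVALENCES; a splitting A ∧ B ⟹ RH is
CONDITIONAL bookkeeping unless A and B are both proved; nothing here bears on the truth of RH.»
-/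

noncomputable section

set_option linter.dupNamespace false

open Complex Polynomial Filter Topology
open scoped Nat Real ComplexConjugate

namespace Summit.RiemannHypothesis.RiemannHypothesis.Theorems.Splittings.JensenMixedSplit

open Literature.Barriers.RiemannHypothesis
open Literature.NumberTheory.LFunctions (jensenPoly exists_sq_eq iteratedDeriv_conj_of_conj)
open Literature.Analysis.TotalPositivity (IsEntireOfOrderLtOne)
open Literature.Analysis.Complex.Obreschkoff (sector mem_sector splits_jensenPoly_taylor_of_zeros_mem_sector)

/-! ## §5 (GENERATION 3) The analytic input is now a THEOREM: every zero of `F'_{(kπ)²,ε}` is real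

No Rouché, no argument principle. Write `F' = 2z·C + q·C'` with `z = w + c`, `C = cosh √w`, `q = z² + ε²`,
and `w = u²`, so `C(w) = cosh u`, `2u·C'(w) = sinh u`.
* OUTSIDE the Jensen disc (`‖z‖ ≥ ε`, `Im w ≠ 0`): `2u·F' = 4zu·cosh u + q·sinh u`; multiplying by
  `conj q · conj (cosh u) · conj u` and taking imaginary parts gives
  `4‖u‖²‖cosh u‖²·Im z·(ε² − ‖z‖²) + ‖q‖²·(Re u · sin (2 Im u) − Im u · sinh (2 Re u))/2 = 0`,
  impossible after multiplication by `Im z = 2 Re u Im u ≠ 0`: the first product is `≤ 0` and the second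
  is `< 0` by `t sin t < t² < t sinh t` (`t ≠ 0`).
* INSIDE (`0 < ‖z‖ < ε ≤ 1`): with `u₀ = kπ·i` (`u₀² = −c`) and the square root `u` on the side of `u₀`,
  `η = u − u₀` satisfies `η (u + u₀) = z`, `‖u + u₀‖ ≥ kπ ≥ 3`, so `‖η‖ ≤ ‖z‖/3`; `cosh u = ± cosh η`,
  `sinh u = ± sinh η`, `‖cosh η − 1‖ ≤ ‖η‖²`, `‖sinh η‖ ≤ 2‖η‖`; hence `‖C‖ ≥ 8/9`, `‖C'‖ ≤ ‖z‖/8`,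
  `‖q‖ ≤ 2`, and `‖2zC‖ ≥ 16‖z‖/9 > ‖z‖/4 ≥ ‖qC'‖`, so `F' ≠ 0`.
(The one zero of `F'` near `−c` is the real critical zero `w = −c` itself: `C'(−c) = 0`.) -/

/-- **Outside the Jensen disc.** If `Im w ≠ 0` and `‖w + c‖ ≥ ε ≥ 0` then `F'_{c,ε}(w) ≠ 0`
(any real `c`). [folklore] -/
theorem deriv_Fw_ne_zero_of_le_norm {c ε : ℝ} (hε : 0 ≤ ε) {w : ℂ} (hv : w.im ≠ 0)
    (hzε : ε ≤ ‖w + c‖) : deriv ((fun w : ℂ ↦ ((w + c) ^ 2 + (ε : ℂ) ^ 2) * coshSqrt w)) w ≠ 0 := by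
  intro hF
  obtain ⟨u, rfl⟩ := exists_sq_eq w
  obtain ⟨z, hzd⟩ : ∃ z : ℂ, u ^ 2 + (c : ℂ) = z := ⟨_, rfl⟩
  obtain ⟨q, hqd⟩ : ∃ q : ℂ, ((u ^ 2 + c) ^ 2 + (ε : ℂ) ^ 2) = q := ⟨_, rfl⟩
  have hq : q = z ^ 2 + (ε : ℂ) ^ 2 := by rw [← hqd, ← hzd]
  rw [hzd] at hzε
  have hwim : (u ^ 2).im = 2 * u.re * u.im := by rw [sq, Complex.mul_im]; ring
  have hzim : z.im = 2 * u.re * u.im := by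
    rw [← hzd, Complex.add_im, Complex.ofReal_im, add_zero, hwim]
  have ha : u.re ≠ 0 := fun h ↦ hv (by rw [hwim, h]; ring)
  have hb : u.im ≠ 0 := fun h ↦ hv (by rw [hwim, h]; ring)
  have hCne : Complex.cosh u ≠ 0 := fun h ↦ by
    rw [← coshSqrt_sq] at h
    exact hv (im_eq_zero_of_coshSqrt_eq_zero h).1
  -- `2u · F'(u²) = 4 z u cosh u + q sinh u = 0`
  have hE : 4 * z * u * Complex.cosh u + q * Complex.sinh u = 0 := by
    rw [deriv_Fw, hqd, hzd] at hF
    have h2 : (2 * z * coshSqrt (u ^ 2) + q * deriv coshSqrt (u ^ 2)) * (2 * u) = 0 := by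
      rw [hF, zero_mul]
    rw [← deriv_coshSqrt_sq_mul, ← coshSqrt_sq, ← h2]
    ring
  by_cases hq0 : q = 0
  · rw [hq0, zero_mul, add_zero] at hE
    have hz0 : z ≠ 0 := fun h ↦ by
      have him := congrArg Complex.im h
      rw [hzim, Complex.zero_im] at him
      exact mul_ne_zero (mul_ne_zero two_ne_zero ha) hb him
    have hu0 : u ≠ 0 := fun h ↦ ha (by rw [h, Complex.zero_re])
    exact mul_ne_zero (mul_ne_zero (mul_ne_zero (by norm_num : (4 : ℂ) ≠ 0) hz0) hu0) hCne hE
  · -- multiply by `conj q · conj (cosh u) · conj u`, take imaginary parts, multiply by `Im z`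
    have hprod : (4 * z * u * Complex.cosh u + q * Complex.sinh u) *
        (conj q * conj (Complex.cosh u) * conj u) =
        ((4 * Complex.normSq u * Complex.normSq (Complex.cosh u) : ℝ) : ℂ) * (z * conj q) +
          ((Complex.normSq q : ℝ) : ℂ) * (Complex.sinh u * conj (Complex.cosh u) * conj u) := by
      push_cast
      rw [← Complex.mul_conj u, ← Complex.mul_conj (Complex.cosh u), ← Complex.mul_conj q]
      ring
    have hzq : (z * conj q).im = z.im * (ε ^ 2 - Complex.normSq z) := by
      rw [hq]; exact im_mul_conj_sq_add z ε
    have him := congrArg Complex.im hprod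
    rw [hE, zero_mul, Complex.zero_im, Complex.add_im, Complex.im_ofReal_mul, Complex.im_ofReal_mul,
      hzq, im_sinh_mul_conj_cosh_mul_conj, hzim] at him
    have hnz : ε ^ 2 ≤ Complex.normSq z := by
      rw [Complex.normSq_eq_norm_sq]; nlinarith [norm_nonneg z]
    have hnq : 0 < Complex.normSq q := Complex.normSq_pos.2 hq0
    have hkey := mul_mul_sub_neg ha hb
    have h4 : 0 ≤ 4 * Complex.normSq u * Complex.normSq (Complex.cosh u) := by
      have := Complex.normSq_nonneg u
      have := Complex.normSq_nonneg (Complex.cosh u)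
      positivity
    have hA : 4 * Complex.normSq u * Complex.normSq (Complex.cosh u) *
        (2 * u.re * u.im * (ε ^ 2 - Complex.normSq z)) * (2 * u.re * u.im) ≤ 0 := by
      have h5 : 0 ≤ (2 * u.re * u.im) ^ 2 * (Complex.normSq z - ε ^ 2) :=
        mul_nonneg (sq_nonneg _) (sub_nonneg.2 hnz)
      have h6 := mul_nonneg h4 h5
      nlinarith [h6]
    have hB : Complex.normSq q * ((u.re * Real.sin (2 * u.im) - u.im * Real.sinh (2 * u.re)) / 2) *
        (2 * u.re * u.im) < 0 := by
      have e : Complex.normSq q * ((u.re * Real.sin (2 * u.im) - u.im * Real.sinh (2 * u.re)) / 2) *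
          (2 * u.re * u.im) =
          Complex.normSq q * (u.re * u.im * (u.re * Real.sin (2 * u.im) - u.im * Real.sinh (2 * u.re))) := by
        ring
      rw [e]
      exact mul_neg_of_pos_of_neg hnq hkey
    have h0 := congrArg (· * (2 * u.re * u.im)) him
    simp only [zero_mul, add_mul] at h0
    linarith

/-- `‖cosh η − 1‖ ≤ ‖η‖²` for `‖η‖ ≤ 1`. [folklore] -/
theorem norm_cosh_sub_one_le {η : ℂ} (h : ‖η‖ ≤ 1) : ‖Complex.cosh η - 1‖ ≤ ‖η‖ ^ 2 := by
  have e : 2 * (Complex.cosh η - 1) =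
      (Complex.exp η - 1 - η) + (Complex.exp (-η) - 1 - (-η)) := by
    rw [mul_sub, Complex.two_cosh]; ring
  have h1 := Complex.norm_exp_sub_one_sub_id_le h
  have h2 := Complex.norm_exp_sub_one_sub_id_le (x := -η) (by rwa [norm_neg])
  rw [norm_neg] at h2
  have h3 : ‖2 * (Complex.cosh η - 1)‖ ≤ ‖η‖ ^ 2 + ‖η‖ ^ 2 := by
    rw [e]; exact (norm_add_le _ _).trans (add_le_add h1 h2)
  rw [norm_mul, Complex.norm_two] at h3
  linarith

/-- `‖sinh η‖ ≤ 2‖η‖` for `‖η‖ ≤ 1`. [folklore] -/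
theorem norm_sinh_le {η : ℂ} (h : ‖η‖ ≤ 1) : ‖Complex.sinh η‖ ≤ 2 * ‖η‖ := by
  have e : 2 * Complex.sinh η = (Complex.exp η - 1) - (Complex.exp (-η) - 1) := by
    rw [Complex.two_sinh]; ring
  have h1 := Complex.norm_exp_sub_one_le h
  have h2 := Complex.norm_exp_sub_one_le (x := -η) (by rwa [norm_neg])
  rw [norm_neg] at h2
  have h3 : ‖2 * Complex.sinh η‖ ≤ 2 * ‖η‖ + 2 * ‖η‖ := by
    rw [e]; exact (norm_sub_le _ _).trans (add_le_add h1 h2)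
  rw [norm_mul, Complex.norm_two] at h3
  linarith

/-- **Inside the Jensen disc.** For `c = (kπ)²`, `k ≥ 1`, `ε ≤ 1`: if `0 < ‖w + c‖ < ε` then
`F'_{c,ε}(w) ≠ 0`. [folklore] -/
theorem deriv_Fw_ne_zero_of_norm_lt {k : ℕ} (hk : 1 ≤ k) {ε : ℝ} (hε1 : ε ≤ 1) {w : ℂ}
    (hz0 : w + ((((k : ℝ) * Real.pi) ^ 2 : ℝ) : ℂ) ≠ 0)
    (hzε : ‖w + ((((k : ℝ) * Real.pi) ^ 2 : ℝ) : ℂ)‖ < ε) :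
    deriv ((fun w : ℂ ↦ ((w + ((((k : ℝ) * Real.pi) ^ 2 : ℝ) : ℂ)) ^ 2 + (ε : ℂ) ^ 2) * coshSqrt w)) w ≠ 0 := by
  intro hF
  have hkπ : (3 : ℝ) ≤ (k : ℝ) * Real.pi := by
    have h1 : (1 : ℝ) ≤ k := by exact_mod_cast hk
    nlinarith [Real.pi_gt_three]
  have hε0 : 0 < ε := lt_of_le_of_lt (norm_nonneg _) hzε
  -- the base point `u₀ = kπ·i`, `u₀² = -c`
  obtain ⟨u₀, hu₀⟩ : ∃ u₀ : ℂ, (((k : ℝ) * Real.pi : ℝ) : ℂ) * I = u₀ := ⟨_, rfl⟩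
  have hu₀sq : u₀ ^ 2 = -((((k : ℝ) * Real.pi) ^ 2 : ℝ) : ℂ) := by
    rw [← hu₀, mul_pow, I_sq]; push_cast; ring
  have hu₀norm : ‖u₀‖ = (k : ℝ) * Real.pi := by
    rw [← hu₀, norm_mul, Complex.norm_I, mul_one, Complex.norm_real, Real.norm_eq_abs,
      abs_of_nonneg (by positivity)]
  have hsinu₀ : Complex.sinh u₀ = 0 := by
    rw [← hu₀, Complex.sinh_mul_I, ← Complex.ofReal_sin, Real.sin_nat_mul_pi]; simp
  have hnc : ‖Complex.cosh u₀‖ = 1 := by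
    rw [← hu₀, Complex.cosh_mul_I, ← Complex.ofReal_cos, Real.cos_nat_mul_pi, Complex.norm_real,
      Real.norm_eq_abs, abs_pow, abs_neg, abs_one, one_pow]
  -- a square root `u` of `w` on the side of `u₀`
  obtain ⟨u, hu, hside⟩ : ∃ u : ℂ, u ^ 2 = w ∧ ‖u - u₀‖ ≤ ‖u + u₀‖ := by
    obtain ⟨u₁, hu₁⟩ := exists_sq_eq w
    rcases le_total ‖u₁ - u₀‖ ‖u₁ + u₀‖ with h | h
    · exact ⟨u₁, hu₁, h⟩
    · refine ⟨-u₁, by rw [neg_sq]; exact hu₁, ?_⟩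
      rwa [show -u₁ - u₀ = -(u₁ + u₀) by ring, norm_neg, show -u₁ + u₀ = -(u₁ - u₀) by ring,
        norm_neg]
  subst hu
  obtain ⟨η, hη⟩ : ∃ η : ℂ, u - u₀ = η := ⟨_, rfl⟩
  obtain ⟨s, hs⟩ : ∃ s : ℂ, u + u₀ = s := ⟨_, rfl⟩
  obtain ⟨z, hzd⟩ : ∃ z : ℂ, u ^ 2 + ((((k : ℝ) * Real.pi) ^ 2 : ℝ) : ℂ) = z := ⟨_, rfl⟩
  rw [hη, hs] at hside
  rw [hzd] at hz0 hzε
  have huη : u = u₀ + η := by rw [← hη]; ring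
  have hsz : s * η = z := by
    rw [← hs, ← hη, ← hzd, ← neg_neg ((((k : ℝ) * Real.pi) ^ 2 : ℝ) : ℂ), ← hu₀sq]; ring
  -- `‖s‖ ≥ 3`, `3‖η‖ ≤ ‖z‖ < 1`
  have hs3 : (3 : ℝ) ≤ ‖s‖ := by
    have h1 : 2 * ‖u₀‖ ≤ ‖s‖ + ‖η‖ := by
      calc 2 * ‖u₀‖ = ‖s - η‖ := by
            rw [← hs, ← hη, show u + u₀ - (u - u₀) = 2 * u₀ by ring, norm_mul, Complex.norm_two]
        _ ≤ ‖s‖ + ‖η‖ := norm_sub_le _ _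
    linarith [hside, hu₀norm]
  have hz1 : ‖z‖ < 1 := lt_of_lt_of_le hzε hε1
  have hη3 : 3 * ‖η‖ ≤ ‖z‖ := by
    calc 3 * ‖η‖ ≤ ‖s‖ * ‖η‖ := by gcongr
      _ = ‖z‖ := by rw [← norm_mul, hsz]
  have hη1 : ‖η‖ ≤ 1 := by linarith [norm_nonneg z]
  -- `cosh u = cosh u₀ cosh η`, `sinh u = cosh u₀ sinh η`
  have hcoshu : Complex.cosh u = Complex.cosh u₀ * Complex.cosh η := by
    rw [huη, Complex.cosh_add, hsinu₀, zero_mul, add_zero]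
  have hsinhu : Complex.sinh u = Complex.cosh u₀ * Complex.sinh η := by
    rw [huη, Complex.sinh_add, hsinu₀, zero_mul, zero_add]
  -- `‖C‖ ≥ 1 - ‖η‖²`
  have hnC : 1 - ‖η‖ ^ 2 ≤ ‖coshSqrt (u ^ 2)‖ := by
    rw [coshSqrt_sq, hcoshu, norm_mul, hnc, one_mul]
    have h1 := norm_cosh_sub_one_le hη1
    have h2 : ‖(1 : ℂ)‖ ≤ ‖Complex.cosh η‖ + ‖Complex.cosh η - 1‖ := by
      calc ‖(1 : ℂ)‖ = ‖Complex.cosh η - (Complex.cosh η - 1)‖ := by rw [sub_sub_cancel]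
        _ ≤ ‖Complex.cosh η‖ + ‖Complex.cosh η - 1‖ := norm_sub_le _ _
    rw [norm_one] at h2
    linarith
  -- `‖u‖ ≥ 8/3` and `‖C'‖ · (8/3) ≤ ‖η‖`
  have hnu : (8 / 3 : ℝ) ≤ ‖u‖ := by
    have h1 : ‖u₀‖ ≤ ‖u‖ + ‖η‖ := by
      calc ‖u₀‖ = ‖u - η‖ := by rw [← hη, sub_sub_cancel]
        _ ≤ ‖u‖ + ‖η‖ := norm_sub_le _ _
    linarith [hu₀norm, hkπ, norm_nonneg z]
  have hnC' : ‖deriv coshSqrt (u ^ 2)‖ * (8 / 3) ≤ ‖η‖ := by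
    have h1 : ‖deriv coshSqrt (u ^ 2)‖ * (2 * ‖u‖) = ‖Complex.sinh η‖ := by
      have h := congrArg (fun t : ℂ ↦ ‖t‖) (deriv_coshSqrt_sq_mul u)
      simp only [norm_mul, Complex.norm_two] at h
      rw [h, hsinhu, norm_mul, hnc, one_mul]
    have h2 := norm_sinh_le hη1
    have h3 : ‖deriv coshSqrt (u ^ 2)‖ * (8 / 3) ≤ ‖deriv coshSqrt (u ^ 2)‖ * ‖u‖ :=
      mul_le_mul_of_nonneg_left hnu (norm_nonneg _)
    linarith
  -- `‖q‖ ≤ 2`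
  have hq : ‖z ^ 2 + (ε : ℂ) ^ 2‖ ≤ 2 := by
    have hz2 : ‖z‖ ^ 2 ≤ 1 := by nlinarith [norm_nonneg z]
    have hε2 : ε ^ 2 ≤ 1 := by nlinarith
    calc ‖z ^ 2 + (ε : ℂ) ^ 2‖ ≤ ‖z ^ 2‖ + ‖(ε : ℂ) ^ 2‖ := norm_add_le _ _
      _ = ‖z‖ ^ 2 + ε ^ 2 := by
          rw [norm_pow, norm_pow, Complex.norm_real, Real.norm_eq_abs, sq_abs]
      _ ≤ 2 := by linarith
  -- the equation `2 z C = -q C'` in norm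
  rw [deriv_Fw, hzd] at hF
  have hF' : 2 * z * coshSqrt (u ^ 2) =
      -((z ^ 2 + (ε : ℂ) ^ 2) * deriv coshSqrt (u ^ 2)) :=
    eq_neg_of_add_eq_zero_left hF
  have hnorm : 2 * ‖z‖ * ‖coshSqrt (u ^ 2)‖ ≤ 2 * ‖deriv coshSqrt (u ^ 2)‖ := by
    have h := congrArg (fun t : ℂ ↦ ‖t‖) hF'
    simp only [norm_mul, Complex.norm_two, norm_neg] at h
    rw [h]
    exact mul_le_mul_of_nonneg_right hq (norm_nonneg _)
  have hzpos : 0 < ‖z‖ := norm_pos_iff.2 hz0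
  have hη19 : ‖η‖ ^ 2 ≤ 1 / 9 := by nlinarith [norm_nonneg η]
  have hC89 : 8 / 9 ≤ ‖coshSqrt (u ^ 2)‖ := by linarith
  have h7 := mul_le_mul_of_nonneg_left hC89 hzpos.le
  nlinarith [h7, hnorm, hnC', hη3, norm_nonneg (deriv coshSqrt (u ^ 2))]

/-- **THEOREM (g2's analytic input `[D]`, discharged).** For `c = (kπ)²`, `k ≥ 1`, `0 < ε ≤ 1`,
every zero of `F'_{c,ε}` is real. [folklore] -/
theorem derivZerosReal_Fw {k : ℕ} (hk : 1 ≤ k) {ε : ℝ} (hε : 0 < ε) (hε1 : ε ≤ 1) :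
    (∀ w : ℂ, deriv (fun w : ℂ ↦ ((w + ((((k : ℝ) * Real.pi) ^ 2 : ℝ) : ℂ)) ^ 2
        + (ε : ℂ) ^ 2) * coshSqrt w) w = 0 → w.im = 0) := by
  intro w hw
  by_contra hv
  rcases lt_or_ge ‖w + ((((k : ℝ) * Real.pi) ^ 2 : ℝ) : ℂ)‖ ε with hlt | hle
  · refine deriv_Fw_ne_zero_of_norm_lt hk hε1 ?_ hlt hw
    intro h0
    have him := congrArg Complex.im h0
    rw [Complex.add_im, Complex.ofReal_im, add_zero, Complex.zero_im] at him
    exact hv him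
  · exact deriv_Fw_ne_zero_of_le_norm hε.le hv hle hw

/-- The real critical zero: `F'(-c) = 0` for `c = (kπ)²`, `k ≥ 1` (so `DerivZerosReal` is not vacuous,
and the Jensen disc `‖w + c‖ ≤ ε` does contain a zero of `F'`). [folklore] -/
theorem deriv_Fw_neg_c {k : ℕ} (hk : 1 ≤ k) (ε : ℝ) :
    deriv ((fun w : ℂ ↦ ((w + ((((k : ℝ) * Real.pi) ^ 2 : ℝ) : ℂ)) ^ 2 + (ε : ℂ) ^ 2)
        * coshSqrt w)) (-((((k : ℝ) * Real.pi) ^ 2 : ℝ) : ℂ)) = 0 := by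
  have hu₀sq : ((((k : ℝ) * Real.pi : ℝ) : ℂ) * I) ^ 2 = -((((k : ℝ) * Real.pi) ^ 2 : ℝ) : ℂ) := by
    rw [mul_pow, I_sq]; push_cast; ring
  have hsin : Complex.sinh ((((k : ℝ) * Real.pi : ℝ) : ℂ) * I) = 0 := by
    rw [Complex.sinh_mul_I, ← Complex.ofReal_sin, Real.sin_nat_mul_pi]; simp
  have hC' : deriv coshSqrt (-((((k : ℝ) * Real.pi) ^ 2 : ℝ) : ℂ)) = 0 := by
    have h := deriv_coshSqrt_sq_mul ((((k : ℝ) * Real.pi : ℝ) : ℂ) * I)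
    rw [hu₀sq, hsin] at h
    have hk' : (0 : ℝ) < k := by exact_mod_cast hk
    have hne : (2 : ℂ) * ((((k : ℝ) * Real.pi : ℝ) : ℂ) * I) ≠ 0 := by
      refine mul_ne_zero two_ne_zero (mul_ne_zero ?_ I_ne_zero)
      rw [Complex.ofReal_ne_zero]; positivity
    exact (mul_eq_zero.1 h).resolve_right hne
  rw [deriv_Fw, neg_add_cancel, mul_zero, zero_mul, zero_add, hC', mul_zero]

/-! ## §6 (GENERATION 3) The mixed-split witness family, now HYPOTHESIS-FREE -/

/-- `F_{(kπ)²,ε}` is a `MixedSplitWitness ((kπ)²) D` for `k ≥ 1`, `0 < ε ≤ 1`, `D ε² ≤ (kπ)⁴ + ε²` —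
no analytic input assumed. [cite: Farmer2022, §4] -/
theorem mixedSplitWitness_Fw' {k : ℕ} (hk : 1 ≤ k) {ε : ℝ} (hε : 0 < ε) (hε1 : ε ≤ 1) {D : ℕ}
    (hD : (D : ℝ) * ε ^ 2 ≤ (((k : ℝ) * Real.pi) ^ 2) ^ 2 + ε ^ 2) :
    let F : ℂ → ℂ := fun w : ℂ ↦ ((w + ((((k : ℝ) * Real.pi) ^ 2 : ℝ) : ℂ)) ^ 2 + (ε : ℂ) ^ 2) * coshSqrt w
    (IsEntireOfOrderLtOne F ∧
      (∀ z, F (conj z) = conj (F z)) ∧ F 0 ≠ 0 ∧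
      (∀ w : ℂ, F w = 0 → ‖w‖ ≤ ((k : ℝ) * Real.pi) ^ 2 → w.im = 0) ∧ (∃ w : ℂ, F w = 0 ∧ ‖w‖ ≤
          ((k : ℝ) * Real.pi) ^ 2) ∧
      (∀ d n : ℕ, 1 ≤ n → (jensenPoly (taylorCoeffSeq F) d n).Splits) ∧
      (∀ d n : ℕ, d ≤ D → (jensenPoly (taylorCoeffSeq F) d n).Splits) ∧
      {w : ℂ | F w = 0 ∧ w.im ≠ 0}.Finite ∧
      EventuallyHyperbolic (taylorCoeffSeq F) ∧ ¬ AllHyperbolic (taylorCoeffSeq F)) :=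
  mixedSplitWitness_Fw hk hε hD (derivZerosReal_Fw hk hε hε1)

/-- **For every threshold pair `(C, D)` there is a mixed-split witness** — unconditionally.
[cite: Farmer2022, §4] -/
theorem exists_mixedSplitWitness' (C : ℝ) (D : ℕ) :
    ∃ (c : ℝ) (F : ℂ → ℂ), C ≤ c ∧
      (IsEntireOfOrderLtOne F ∧
      (∀ z, F (conj z) = conj (F z)) ∧ F 0 ≠ 0 ∧
      (∀ w : ℂ, F w = 0 → ‖w‖ ≤ c → w.im = 0) ∧ (∃ w : ℂ, F w = 0 ∧ ‖w‖ ≤ c) ∧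
      (∀ d n : ℕ, 1 ≤ n → (jensenPoly (taylorCoeffSeq F) d n).Splits) ∧
      (∀ d n : ℕ, d ≤ D → (jensenPoly (taylorCoeffSeq F) d n).Splits) ∧
      {w : ℂ | F w = 0 ∧ w.im ≠ 0}.Finite ∧
      EventuallyHyperbolic (taylorCoeffSeq F) ∧ ¬ AllHyperbolic (taylorCoeffSeq F)) :=
  exists_mixedSplitWitness C D fun _ _ hk hε hε1 ↦ derivZerosReal_Fw hk hε hε1

/-- **The mixed-split schema is refuted at class level (kernel, no hypothesis).** For no thresholds
`(C, D)` does «zeros of modulus `≤ C` real ∧ rows `n ≥ 1` hyperbolic ∧ degrees `d ≤ D` hyperbolic ∧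
finitely many non-real zeros ∧ EventuallyHyperbolic ⟹ AllHyperbolic» hold for every real entire
function of order `< 1` with `F 0 ≠ 0` — the class in which Pólya's criterion places `xiSq`. Any exchange
lemma of this shape for ξ must use ξ-specific input. [cite: Farmer2022, §4] -/
theorem not_mixedSplit_schema (C : ℝ) (D : ℕ) :
    ¬ ∀ F : ℂ → ℂ, IsEntireOfOrderLtOne F → (∀ z, F (conj z) = conj (F z)) → F 0 ≠ 0 →
      (∀ w : ℂ, F w = 0 → ‖w‖ ≤ C → w.im = 0) →
      (∀ d n : ℕ, 1 ≤ n → (jensenPoly (taylorCoeffSeq F) d n).Splits) →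
      (∀ d n : ℕ, d ≤ D → (jensenPoly (taylorCoeffSeq F) d n).Splits) →
      {w : ℂ | F w = 0 ∧ w.im ≠ 0}.Finite →
      EventuallyHyperbolic (taylorCoeffSeq F) → AllHyperbolic (taylorCoeffSeq F) := by
  intro h
  obtain ⟨c, F, hc, h1, h2, h3, h4, -, h6, h7, h8, h9, h10⟩ := exists_mixedSplitWitness' C D
  exact h10 (h F h1 h2 h3 (fun w hw hn ↦ h4 w hw (hn.trans hc)) h6 h7 h8 h9)

end Summit.RiemannHypothesis.RiemannHypothesis.Theorems.Splittings.JensenMixedSplit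

end
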